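import Mathlib
import Literature.Computability.Complexity.LowDegreeExtension
import HarnessLib

/-!
# Zero tests for low-degree extensions: Schwartz–Zippel in counting form, the subcube zero test, random combinations

Literature / complexity toolkit, fourth brick of the algebraic engine of probabilistically
checkable proofs for exponential-time computations (after `LowDegreeTest.lean`,
`SumcheckField.lean`, `LowDegreeExtension.lean`). The verifier of Babai–Fortnow–Lund /
Babai–Fortnow–Levin–Szegedy must check that a low-degree CONSTRAINT function `Ψ` vanishes on the
whole subcube `Hᴷ`; it does so by (i) combining the constraint families with random
coefficients `λ` and (ii) testing the low-degree extension of `Ψ|_{Hᴷ}` at a random point `ρ`,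
which reduces "`Ψ ≡ 0` on `Hᴷ`" to the single sum `∑_{c ∈ Hᴷ} Ψ(c) ∏ₜ L_{cₜ}(ρₜ) = 0` — a
sumcheck claim (Arora–Barak 2009, §8.6.2 / §11.5.2 "zero on a subcube"; BFLS 1991, §5). Both
steps are instances of the Schwartz–Zippel lemma (Mathlib
`MvPolynomial.schwartz_zippel_totalDegree`), here put in the counting form used by the tree:

* `card_eval_eq_zero_mul_le` — for a nonzero `p ∈ F[X₁, …, X_N]`:
  `#{f ∈ Fᴺ | p(f) = 0} · |F| ≤ deg p · |F|ᴺ`;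
* `ldePoly_ne_zero` — the extension polynomial of a table that does not vanish on `Hᴷ` is nonzero;
  **`card_lde_eq_zero_mul_le`** (the subcube zero test): if `Ψ(c₀) ≠ 0` for some `c₀ ∈ Hᴷ` then
  `#{ρ ∈ Fᴷ | Ψ̂(ρ) = 0} · |F| ≤ K (#H - 1) · |F|ᴷ`, where `Ψ̂ = lde H Ψ` is the sum
  `∑_{c ∈ Hᴷ} Ψ(c) ∏ₜ L_{cₜ}(ρₜ)` checked by the sumcheck protocol;
* **`card_linComb_eq_zero_mul_le`** (random combination of constraint families): if
  `a : Fin N → F` is not identically zero then `#{λ ∈ Fᴺ | ∑ᵢ λᵢ aᵢ = 0} · |F| ≤ |F|ᴺ`.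

## References

* L. Babai, L. Fortnow, L. Levin, M. Szegedy, *Checking computations in polylogarithmic time*,
  STOC 1991, §5 [BFLS1991].
* S. Arora, B. Barak, *Computational Complexity: A Modern Approach*, CUP 2009, Lemma 7.5 / A.36
  (Schwartz–Zippel), §8.6.2, §11.5.2 [AroraBarakCC2009].
* J. T. Schwartz, *Fast probabilistic algorithms for verification of polynomial identities*,
  J. ACM 27 (1980); R. Zippel, EUROSAM 1979 (cited through Mathlib's `SchwartzZippel`).
-/

noncomputable section

open Finset Polynomial

namespace Literature.Computability.Complexity

namespace LowDegreeExtension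

variable {F : Type*} [Field F] [Fintype F] [DecidableEq F]

/-- **Schwartz–Zippel, counting form**: a nonzero polynomial in `N` variables of total degree
`deg p` vanishes on at most a `deg p / |F|` fraction of `Fᴺ`:
`#{f | p(f) = 0} · |F| ≤ deg p · |F|ᴺ`. [Mathlib `MvPolynomial.schwartz_zippel_totalDegree`]
[cite: AroraBarakCC2009, Lemma A.36] -/
theorem card_eval_eq_zero_mul_le {N : ℕ} {p : MvPolynomial (Fin N) F} (hp : p ≠ 0) :
    (univ.filter fun f : Fin N → F => MvPolynomial.eval f p = 0).card * Fintype.card F ≤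
      p.totalDegree * Fintype.card F ^ N := by
  have h := MvPolynomial.schwartz_zippel_totalDegree hp (univ : Finset F)
  rw [Fintype.piFinset_univ, card_univ] at h
  have hF : (0 : ℚ≥0) < Fintype.card F := by exact_mod_cast Fintype.card_pos
  have hFN : (0 : ℚ≥0) < (Fintype.card F : ℚ≥0) ^ N := pow_pos hF N
  rw [div_le_div_iff₀ hFN hF] at h
  exact_mod_cast h

omit [Fintype F] in
/-- The extension polynomial of a table that does not vanish on `Hᴷ` is nonzero (it takes the
value `Ψ(c₀) ≠ 0` at `c₀`). [cite: BFLS1991, §4] -/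
theorem ldePoly_ne_zero {K : ℕ} {H : Finset F} (Ψ : (Fin K → F) → F) {c₀ : Fin K → F}
    (hc₀ : ∀ t, c₀ t ∈ H) (hΨ : Ψ c₀ ≠ 0) : ldePoly H Ψ ≠ 0 := by
  intro h
  apply hΨ
  rw [← lde_apply_of_mem Ψ hc₀, ← eval_ldePoly, h, map_zero]

/-- **The subcube zero test.** If the table `Ψ` does not vanish identically on `Hᴷ`, then its
low-degree extension `Ψ̂(ρ) = ∑_{c ∈ Hᴷ} Ψ(c) ∏ₜ L_{cₜ}(ρₜ)` vanishes on at most a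
`K (#H - 1) / |F|` fraction of the points `ρ ∈ Fᴷ`:
`#{ρ | Ψ̂(ρ) = 0} · |F| ≤ K (#H - 1) · |F|ᴷ`. (So a verifier that samples `ρ` and checks the
sum `Ψ̂(ρ) = 0` by the sumcheck protocol rejects a violated constraint system with high
probability.) [cite: AroraBarakCC2009, §8.6.2] [cite: BFLS1991, §5] -/
theorem card_lde_eq_zero_mul_le {K : ℕ} {H : Finset F} (Ψ : (Fin K → F) → F) {c₀ : Fin K → F}
    (hc₀ : ∀ t, c₀ t ∈ H) (hΨ : Ψ c₀ ≠ 0) :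
    (univ.filter fun ρ : Fin K → F => lde H Ψ ρ = 0).card * Fintype.card F ≤
      K * (H.card - 1) * Fintype.card F ^ K := by
  have h := card_eval_eq_zero_mul_le (ldePoly_ne_zero Ψ hc₀ hΨ)
  simp only [eval_ldePoly] at h
  exact h.trans (Nat.mul_le_mul_right _ (totalDegree_ldePoly_le Ψ))

/-- **Random combination of constraint values.** If `a : Fin N → F` is not identically zero,
then `∑ᵢ λᵢ aᵢ = 0` for at most a `1/|F|` fraction of the coefficient vectors `λ ∈ Fᴺ`:
`#{λ | ∑ᵢ λᵢ aᵢ = 0} · |F| ≤ |F|ᴺ` (Schwartz–Zippel for the nonzero linear form `∑ᵢ aᵢ Xᵢ`).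
[cite: AroraBarakCC2009, §11.5.2] -/
theorem card_linComb_eq_zero_mul_le {N : ℕ} (a : Fin N → F) (ha : ∃ i, a i ≠ 0) :
    (univ.filter fun lam : Fin N → F => ∑ i, lam i * a i = 0).card * Fintype.card F ≤ Fintype.card F ^ N := by
  obtain ⟨i₀, hi₀⟩ := ha
  set p : MvPolynomial (Fin N) F := ∑ i, MvPolynomial.C (a i) * MvPolynomial.X i with hp
  have hpne : p ≠ 0 := by
    intro h
    apply hi₀
    have := congrArg (MvPolynomial.eval (Pi.single i₀ 1)) h
    simp only [hp, map_sum, map_mul, MvPolynomial.eval_C, MvPolynomial.eval_X, map_zero] at this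
    rw [sum_eq_single i₀ (fun i _ hi => by rw [Pi.single_eq_of_ne hi, mul_zero])
      (fun h => absurd (mem_univ _) h)] at this
    simpa using this
  have hdeg : p.totalDegree ≤ 1 := by
    refine (MvPolynomial.totalDegree_finsetSum _ _).trans (Finset.sup_le fun i _ => ?_)
    refine (MvPolynomial.totalDegree_mul _ _).trans ?_
    rw [MvPolynomial.totalDegree_C, zero_add]
    exact (MvPolynomial.totalDegree_X _).le
  have h := card_eval_eq_zero_mul_le hpne
  have heval : ∀ lam : Fin N → F, MvPolynomial.eval lam p = ∑ i, lam i * a i := fun lam => by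
    simp only [hp, map_sum, map_mul, MvPolynomial.eval_C, MvPolynomial.eval_X]
    exact sum_congr rfl fun i _ => mul_comm _ _
  simp only [heval] at h
  exact h.trans ((Nat.mul_le_mul_right _ hdeg).trans (by rw [one_mul]))

end LowDegreeExtension

end Literature.Computability.Complexity

end
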